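import Summits.ABC.ABC.Theorems.CongruentialReceptacleTameLocalReceptacleCellLawsDefs
import Literature.Analysis.Fourier.FourierDecayFromDerivBounds
import Mathlib.Analysis.Fourier.PoissonSummation
import Mathlib.Analysis.Calculus.BumpFunction.InnerProduct

/-!
# Crux `CongruentialReceptacle.TameLocalReceptacle` (stmt-ABC-14354), line `grh-friable-cell-resolution`:
# registered stub `stub_plateauProfiles` — plateau profiles in the `W`-class

Registered stub of the checked skeleton `Cruxes/TameLocalReceptacle/Lines/grh_friable_cell_resolution.lean`
(lead `prover-line-stmt-ABC-14354-a1-0`): `PlateauProfiles` (defined in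
`CongruentialReceptacleTameLocalReceptacleCellLawsDefs.lean`).  For `0 < a − η₀`, `a ≤ b`, `b + η₀ < 1`,
`η₀ > 0` we must produce a real profile `p` with `0 ≤ p ≤ 1`, `p = 1` on `[a, b]`, `p = 0` off
`(a − η₀, b + η₀)`, together with coefficients `c : ℤ → ℂ`, `Σ_ℓ ‖c_ℓ‖ (1 + |ℓ|)³ < ∞`, such that
`p(v) = Σ_ℓ c_ℓ W_ℓ(v)` on `(0, 1]`, where `W_λ(v) = v²(1−v)² e(λv)` (`twistWeight`).

## Proof (running log: everything below is proved, nothing is stuck)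

* `p` is Mathlib's smooth bump `ContDiffBump ((a+b)/2)` with inner radius `(b−a)/2 + η₀/4` and outer
  radius `(b−a)/2 + η₀/2`: `p = 1` on `[a, b]`, `supp p = (a − η₀/2, b + η₀/2) ⊂ (0, 1)`, `0 ≤ p ≤ 1`.
* `g(v) = p(v) / (v²(1−v)²)` is smooth on `ℝ` (the bump vanishes near `0` and `1`) with compact
  support, and so is its complexification (written as explicit lambdas, no new definitions).
* GENERAL FACTS (smooth compactly supported `g : ℝ → ℂ`): the derivatives of orders `≤ N` are uniformly
  bounded, hence (tree: `Literature.Analysis.Fourier.norm_fourier_le_of_iteratedFDeriv_le`, differentiate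
  `N` times under the Fourier integral) `‖𝓕 g(ξ)‖ ≤ K (1 + |ξ|)^{−N}`; with `N = 5`,
  `Σ_n ‖𝓕 g(n)‖ (1 + |n|)³ < ∞`; and Poisson summation (Mathlib's
  `Real.tsum_eq_tsum_fourier_of_rpow_decay_of_summable`) gives the pointwise Fourier expansion
  `Σ_n 𝓕 g(n) e(n x) = Σ_n g(x + n)` as a `HasSum`.
* For `v ∈ (0, 1]` only the term `n = 0` of `Σ_n g(v + n)` survives (`supp g ⊂ (0,1)`), so
  `Σ_ℓ 𝓕 g(ℓ) e(ℓ v) = g(v)`; multiplying by `v²(1−v)²` turns `e(ℓv)` into `W_ℓ(v)` and `g(v)` into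
  `p(v)` (at `v = 1` both sides vanish).  Hence `c_ℓ = 𝓕 g(ℓ)` works.
-/

-- `Summit.<Summit>.<Problem>` is the mandated summit-side namespace (CONVENTIONS §2); for the
-- single-conjunct summit `ABC` the two coincide, so the duplicate `ABC.ABC` is deliberate.
set_option linter.dupNamespace false

noncomputable section

namespace Summit.ABC.ABC.Theorems.TameLocalReceptacle

open Real Complex MeasureTheory Set Filter Asymptotics
open scoped FourierTransform Topology ContDiff
open Literature.NumberTheory.Sieve.TwistedWeight

/-! ## General facts: Fourier coefficients of a smooth compactly supported function on `ℝ` -/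

/-- A smooth compactly supported function has uniformly bounded derivatives of all orders `≤ N`. [folklore] -/
theorem exists_norm_iteratedFDeriv_le_of_hasCompactSupport {g : ℝ → ℂ} (hg : ContDiff ℝ ∞ g)
    (hs : HasCompactSupport g) (N : ℕ) :
    ∃ M : ℝ, ∀ n ≤ N, ∀ x, ‖iteratedFDeriv ℝ n g x‖ ≤ M := by
  have h : ∀ n : ℕ, ∃ C : ℝ, ∀ x, ‖iteratedFDeriv ℝ n g x‖ ≤ C := fun n =>
    (hg.continuous_iteratedFDeriv (by exact_mod_cast le_top)).bounded_above_of_compact_support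
      (hs.iteratedFDeriv n)
  choose C hC using h
  refine ⟨∑ n ∈ Finset.range (N + 1), |C n|, fun n hn x => (hC n x).trans ?_⟩
  exact (le_abs_self _).trans
    (Finset.single_le_sum (fun k _ => abs_nonneg (C k)) (Finset.mem_range.2 (Nat.lt_succ_of_le hn)))

/-- **Decay of the Fourier transform of a smooth compactly supported function**:
`‖𝓕 g(ξ)‖ ≤ K (1 + |ξ|)^{−N}` for every `N`. [folklore] -/
theorem exists_norm_fourier_le_of_hasCompactSupport {g : ℝ → ℂ} (hg : ContDiff ℝ ∞ g)
    (hs : HasCompactSupport g) (N : ℕ) :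
    ∃ K : ℝ, ∀ ξ : ℝ, ‖𝓕 g ξ‖ ≤ K * ((1 + |ξ|) ^ N)⁻¹ := by
  obtain ⟨M, hM⟩ := exists_norm_iteratedFDeriv_le_of_hasCompactSupport hg hs N
  refine ⟨2 ^ N * (M * (volume (tsupport g)).toReal), fun ξ => ?_⟩
  have h := Literature.Analysis.Fourier.norm_fourier_le_of_iteratedFDeriv_le hg hs hM le_rfl ξ
  simpa only [Real.norm_eq_abs] using h

/-- `Σ_{n ∈ ℤ} ‖𝓕 g(n)‖ (1 + |n|)³ < ∞` for a smooth compactly supported `g`. [folklore] -/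
theorem summable_norm_fourier_mul_pow_three {g : ℝ → ℂ} (hg : ContDiff ℝ ∞ g) (hs : HasCompactSupport g) :
    Summable (fun n : ℤ => ‖𝓕 g n‖ * (1 + |(n : ℝ)|) ^ 3) := by
  obtain ⟨K, hK⟩ := exists_norm_fourier_le_of_hasCompactSupport hg hs 5
  -- the majorant `K (1+|n|)^{-2}`, dominated off `0` by `K / n²`
  have hmaj : Summable (fun n : ℤ => K * ((1 + |(n : ℝ)|) ^ 2)⁻¹) := by
    refine Summable.mul_left K ?_
    refine Summable.of_norm_bounded_eventually (Real.summable_one_div_int_pow.mpr one_lt_two) ?_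
    filter_upwards [eventually_cofinite_ne (0 : ℤ)] with n hn
    have hn' : (n : ℝ) ≠ 0 := by exact_mod_cast hn
    rw [Real.norm_eq_abs, abs_of_nonneg (by positivity), one_div]
    refine inv_anti₀ (by positivity) ?_
    rw [← sq_abs (n : ℝ)]
    exact pow_le_pow_left₀ (abs_nonneg _) (by linarith [abs_nonneg (n : ℝ)]) 2
  refine Summable.of_nonneg_of_le (fun n => by positivity) (fun n => ?_) hmaj
  have ht : (1 + |(n : ℝ)|) ≠ 0 := by positivity
  calc ‖𝓕 g n‖ * (1 + |(n : ℝ)|) ^ 3 ≤ K * ((1 + |(n : ℝ)|) ^ 5)⁻¹ * (1 + |(n : ℝ)|) ^ 3 :=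
        mul_le_mul_of_nonneg_right (hK n) (by positivity)
    _ = K * ((1 + |(n : ℝ)|) ^ 2)⁻¹ := by field_simp

/-- The Fourier transform of a smooth compactly supported `g` is summable over `ℤ`. [folklore] -/
theorem summable_fourier_intCast {g : ℝ → ℂ} (hg : ContDiff ℝ ∞ g) (hs : HasCompactSupport g) :
    Summable (fun n : ℤ => 𝓕 g n) := by
  refine Summable.of_norm (Summable.of_nonneg_of_le (fun n => norm_nonneg _) (fun n => ?_)
    (summable_norm_fourier_mul_pow_three hg hs))
  exact le_mul_of_one_le_right (norm_nonneg _) (one_le_pow₀ (by linarith [abs_nonneg (n : ℝ)]))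

/-- **Poisson summation, pointwise `HasSum` form**: for a smooth compactly supported `g : ℝ → ℂ`,
`Σ_n 𝓕 g(n) e(nx) = Σ_n g(x + n)`. [folklore] -/
theorem hasSum_fourier_mul_fourier {g : ℝ → ℂ} (hg : ContDiff ℝ ∞ g) (hs : HasCompactSupport g) (x : ℝ) :
    HasSum (fun n : ℤ => 𝓕 g n * fourier n (x : UnitAddCircle)) (∑' n : ℤ, g (x + n)) := by
  have hsum := summable_fourier_intCast hg hs
  have hO : g =O[cocompact ℝ] (fun x : ℝ => |x| ^ (-(2 : ℝ))) := by
    have h0 : g =ᶠ[cocompact ℝ] (fun _ => 0) := by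
      filter_upwards [(show IsCompact (tsupport g) from hs).compl_mem_cocompact] with y hy
      exact image_eq_zero_of_notMem_tsupport hy
    exact (isBigO_zero _ _).congr' h0.symm EventuallyEq.rfl
  rw [Real.tsum_eq_tsum_fourier_of_rpow_decay_of_summable hg.continuous one_lt_two hO hsum x]
  refine (Summable.of_norm_bounded hsum.norm (fun n => ?_)).hasSum
  have h1 : ‖fourier n (x : UnitAddCircle)‖ = 1 := by rw [fourier_apply]; exact Circle.norm_coe _
  rw [norm_mul, h1, mul_one]

/-- `e(n x) = fourier n (x)` on the unit circle. [folklore] -/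
theorem fourierChar_intCast_mul (n : ℤ) (x : ℝ) : (𝐞 ((n : ℝ) * x) : ℂ) = fourier n (x : UnitAddCircle) := by
  rw [fourier_coe_apply, Real.fourierChar_apply]
  congr 1
  push_cast
  ring

/-- **Fourier expansion against the weights `W_ℓ`**: for a smooth compactly supported `g : ℝ → ℂ` whose
nonzero integer translates vanish at `v ∈ (0, 1]` (i.e. `Σ_n g(v + n) = g(v)`),
`Σ_ℓ 𝓕 g(ℓ) W_ℓ(v) = v²(1−v)² g(v)`. [folklore] -/
theorem hasSum_fourier_mul_twistWeight {g : ℝ → ℂ} (hg : ContDiff ℝ ∞ g) (hs : HasCompactSupport g)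
    {v : ℝ} (hv : v ∈ Ioc (0 : ℝ) 1) (hper : ∑' n : ℤ, g (v + n) = g v) :
    HasSum (fun ℓ : ℤ => 𝓕 g ℓ * twistWeight (ℓ : ℝ) v) ((((v ^ 2 * (1 - v) ^ 2 : ℝ)) : ℂ) * g v) := by
  have hS := hasSum_fourier_mul_fourier hg hs v
  rw [hper] at hS
  have hfun : (fun ℓ : ℤ => 𝓕 g ℓ * twistWeight (ℓ : ℝ) v) =
      fun ℓ : ℤ => (((v ^ 2 * (1 - v) ^ 2 : ℝ)) : ℂ) * (𝓕 g ℓ * fourier ℓ (v : UnitAddCircle)) := by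
    funext ℓ
    rw [twistWeight_of_mem hv, fourierChar_intCast_mul]
    ring
  rw [hfun]
  exact hS.mul_left _

/-! ## The bump divided by `v²(1−v)²`

For a smooth bump `P` (Mathlib's `ContDiffBump m`) supported inside `(0, 1)` we use the function
`v ↦ P(v) / (v²(1−v)²)` (junk value `0` at `v = 0, 1` by `x / 0 = 0`, where `P` vanishes anyway) and its
complexification; no new definitions are introduced, the lambdas are written out. -/

variable {m : ℝ}

/-- `P(v) / (v²(1−v)²)` vanishes where the bump `P` does. [folklore] -/
theorem bump_div_eq_zero (P : ContDiffBump m) {v : ℝ} (hv : P.rOut ≤ dist v m) :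
    P v / (v ^ 2 * (1 - v) ^ 2) = 0 := by
  rw [P.zero_of_le_dist hv, zero_div]

/-- `P(v) / (v²(1−v)²) = 0` to the left of the support. [folklore] -/
theorem bump_div_eq_zero_of_le (P : ContDiffBump m) {v : ℝ} (hv : v ≤ m - P.rOut) :
    P v / (v ^ 2 * (1 - v) ^ 2) = 0 :=
  bump_div_eq_zero P (by rw [Real.dist_eq, abs_sub_comm, abs_of_nonneg (by linarith [P.rOut_pos])]; linarith)

/-- `P(v) / (v²(1−v)²) = 0` to the right of the support. [folklore] -/
theorem bump_div_eq_zero_of_ge (P : ContDiffBump m) {v : ℝ} (hv : m + P.rOut ≤ v) :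
    P v / (v ^ 2 * (1 - v) ^ 2) = 0 :=
  bump_div_eq_zero P (by rw [Real.dist_eq, abs_of_nonneg (by linarith [P.rOut_pos])]; linarith)

/-- `v ↦ P(v) / (v²(1−v)²)` is smooth on `ℝ` when the support of `P` lies inside `(0, 1)`. [folklore] -/
theorem contDiff_bump_div (P : ContDiffBump m) (h0 : 0 < m - P.rOut) (h1 : m + P.rOut < 1) :
    ContDiff ℝ ∞ (fun v : ℝ => P v / (v ^ 2 * (1 - v) ^ 2)) := by
  refine contDiff_iff_contDiffAt.2 fun v => ?_
  by_cases hv : v ^ 2 * (1 - v) ^ 2 = 0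
  · -- `v = 0` or `v = 1`: the function vanishes near `v`
    have hv' : v = 0 ∨ v = 1 := by
      rcases mul_eq_zero.1 hv with h | h
      · exact Or.inl (pow_eq_zero_iff two_ne_zero |>.1 h)
      · right; have := (pow_eq_zero_iff two_ne_zero).1 h; linarith
    have hev : (fun w : ℝ => P w / (w ^ 2 * (1 - w) ^ 2)) =ᶠ[𝓝 v] fun _ => 0 := by
      rcases hv' with rfl | rfl
      · filter_upwards [Iio_mem_nhds h0] with w hw
        exact bump_div_eq_zero_of_le P hw.le
      · filter_upwards [Ioi_mem_nhds h1] with w hw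
        exact bump_div_eq_zero_of_ge P hw.le
    exact contDiffAt_const.congr_of_eventuallyEq hev
  · exact P.contDiffAt.div ((contDiff_id.pow 2).mul ((contDiff_const.sub contDiff_id).pow 2)).contDiffAt hv

/-- `v ↦ P(v) / (v²(1−v)²)` has compact support. [folklore] -/
theorem hasCompactSupport_bump_div (P : ContDiffBump m) :
    HasCompactSupport (fun v : ℝ => P v / (v ^ 2 * (1 - v) ^ 2)) :=
  P.hasCompactSupport.mono fun v hv hP => hv (show P v / (v ^ 2 * (1 - v) ^ 2) = 0 by rw [hP, zero_div])

/-- The complexification `v ↦ (P(v) / (v²(1−v)²) : ℂ)` is smooth. [folklore] -/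
theorem contDiff_bump_divC (P : ContDiffBump m) (h0 : 0 < m - P.rOut) (h1 : m + P.rOut < 1) :
    ContDiff ℝ ∞ (fun v : ℝ => (((P v / (v ^ 2 * (1 - v) ^ 2) : ℝ)) : ℂ)) :=
  ofRealCLM.contDiff.comp (contDiff_bump_div P h0 h1)

/-- The complexification has compact support. [folklore] -/
theorem hasCompactSupport_bump_divC (P : ContDiffBump m) :
    HasCompactSupport (fun v : ℝ => (((P v / (v ^ 2 * (1 - v) ^ 2) : ℝ)) : ℂ)) :=
  (hasCompactSupport_bump_div P).comp_left (g := fun x : ℝ => (x : ℂ)) Complex.ofReal_zero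

/-- For `v ∈ (0, 1]` and an integer `n ≠ 0`, `v + n` is outside the support. [folklore] -/
theorem bump_divC_add_intCast (P : ContDiffBump m) (h0 : 0 < m - P.rOut) (h1 : m + P.rOut < 1) {v : ℝ}
    (hv : v ∈ Ioc (0 : ℝ) 1) {n : ℤ} (hn : n ≠ 0) :
    (((P (v + n) / ((v + n) ^ 2 * (1 - (v + n)) ^ 2) : ℝ)) : ℂ) = 0 := by
  rw [Complex.ofReal_eq_zero]
  rcases lt_or_gt_of_ne hn with h | h
  · have h' : (n : ℝ) ≤ -1 := by exact_mod_cast (show n ≤ -1 by omega)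
    exact bump_div_eq_zero_of_le P (by linarith [hv.2])
  · have h' : (1 : ℝ) ≤ n := by exact_mod_cast (show 1 ≤ n by omega)
    exact bump_div_eq_zero_of_ge P (by linarith [hv.1])

/-- The periodisation of the complexification agrees with it on `(0, 1]`. [folklore] -/
theorem tsum_bump_divC_add_intCast (P : ContDiffBump m) (h0 : 0 < m - P.rOut) (h1 : m + P.rOut < 1)
    {v : ℝ} (hv : v ∈ Ioc (0 : ℝ) 1) :
    ∑' n : ℤ, (((P (v + n) / ((v + n) ^ 2 * (1 - (v + n)) ^ 2) : ℝ)) : ℂ) =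
      (((P v / (v ^ 2 * (1 - v) ^ 2) : ℝ)) : ℂ) := by
  rw [tsum_eq_single 0 fun n hn => bump_divC_add_intCast P h0 h1 hv hn]
  simp

/-- `v²(1−v)² · (P(v) / (v²(1−v)²)) = P(v)` on `(0, 1]` (at `v = 1` both sides vanish). [folklore] -/
theorem sq_mul_bump_divC (P : ContDiffBump m) (h1 : m + P.rOut < 1) {v : ℝ} (hv : v ∈ Ioc (0 : ℝ) 1) :
    (((v ^ 2 * (1 - v) ^ 2 : ℝ)) : ℂ) * (((P v / (v ^ 2 * (1 - v) ^ 2) : ℝ)) : ℂ) = ((P v : ℝ) : ℂ) := by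
  rw [← Complex.ofReal_mul]
  rcases eq_or_lt_of_le hv.2 with h | h
  · subst h
    rw [P.zero_of_le_dist (by rw [Real.dist_eq, abs_of_nonneg (by linarith [P.rOut_pos])]; linarith)]
    simp
  · have hden : v ^ 2 * (1 - v) ^ 2 ≠ 0 := by
      have := hv.1
      have : 0 < 1 - v := sub_pos.2 h
      positivity
    rw [mul_div_cancel₀ _ hden]

/-! ## The registered stub -/

/-- **Registered stub `stub_plateauProfiles`**: plateau profiles in the `W`-class exist — for
`0 < a − η₀`, `a ≤ b`, `b + η₀ < 1`, `η₀ > 0` there are `p : ℝ → ℝ` with `0 ≤ p ≤ 1`, `p = 1` on `[a, b]`,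
`p = 0` off `(a − η₀, b + η₀)`, and `c : ℤ → ℂ` with `Σ ‖c_ℓ‖(1+|ℓ|)³ < ∞` and `p(v) = Σ_ℓ c_ℓ W_ℓ(v)` on
`(0, 1]` (a smooth bump divided by `v²(1−v)²`, expanded in its Fourier series via Poisson summation).
[folklore] -/
theorem stub_plateauProfiles : PlateauProfiles := by
  intro a b η₀ hη ha hab hb
  -- the bump: centre `(a+b)/2`, radii `(b−a)/2 + η₀/4 < (b−a)/2 + η₀/2`
  let P : ContDiffBump ((a + b) / 2) := ⟨(b - a) / 2 + η₀ / 4, (b - a) / 2 + η₀ / 2, by linarith, by linarith⟩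
  have hrIn : P.rIn = (b - a) / 2 + η₀ / 4 := rfl
  have hrOut : P.rOut = (b - a) / 2 + η₀ / 2 := rfl
  have h0 : 0 < (a + b) / 2 - P.rOut := by rw [hrOut]; linarith
  have h1 : (a + b) / 2 + P.rOut < 1 := by rw [hrOut]; linarith
  have hgc := contDiff_bump_divC P h0 h1
  have hgs := hasCompactSupport_bump_divC P
  refine ⟨P, fun ℓ => 𝓕 (fun v : ℝ => (((P v / (v ^ 2 * (1 - v) ^ 2) : ℝ)) : ℂ)) ℓ,
    summable_norm_fourier_mul_pow_three hgc hgs, ?_, fun v => ⟨P.nonneg, P.le_one⟩, ?_, ?_⟩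
  · -- the Fourier expansion on `(0, 1]`
    intro v hv
    have h := hasSum_fourier_mul_twistWeight hgc hgs hv (tsum_bump_divC_add_intCast P h0 h1 hv)
    rwa [sq_mul_bump_divC P h1 hv] at h
  · -- `p = 1` on `[a, b]`
    intro v hv
    refine P.one_of_mem_closedBall ?_
    rw [Metric.mem_closedBall, Real.dist_eq, hrIn]
    exact abs_le.2 ⟨by linarith [hv.1], by linarith [hv.2]⟩
  · -- `p = 0` off `(a − η₀, b + η₀)`
    intro v hv
    refine P.zero_of_le_dist ?_
    rw [Real.dist_eq, hrOut]
    rcases le_or_gt v (a - η₀) with h | h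
    · rw [abs_sub_comm, abs_of_nonneg (by linarith)]; linarith
    · have h' : b + η₀ ≤ v := by
        by_contra h''
        exact hv ⟨h, not_le.1 h''⟩
      rw [abs_of_nonneg (by linarith)]; linarith

end Summit.ABC.ABC.Theorems.TameLocalReceptacle

end
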